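import Literature.NumberTheory.EllipticCurves.AtkinLehnerProductProofs
import Literature.NumberTheory.EllipticCurves.BSDHeegnerPointsTorsionProofs
import Literature.NumberTheory.EllipticCurves.PAdicLFunctionFrickeSymmetryProofs
import HarnessLib

/-!
# The Atkin–Lehner symmetry of modular symbols whose denominator is divisible by `N/Q`, and of the
# Mazur–Tate–Teitelbaum symbols `[u/p^n]⁺` at a prime `p ‖ N`

Topic `NumberTheory/EllipticCurves` (modular symbols of `f ∈ S₂(Γ₀(N))`, item C9; Atkin–Lehner
involutions `AtkinLehnerInvolutions`; the `p`-adic `L`-function of item C19). Companion of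
`PAdicLFunctionFrickeSymmetryProofs` (the case `Q = N`): the first layer of the functional equation
of the `p`-adic `L`-function at a prime `p ‖ N` of MULTIPLICATIVE reduction (Mazur–Tate–Teitelbaum
1986, §I.17), where the Fricke symmetry `u/m ↔ v/m`, `a m − u N v = 1`, is vacuous (`p ∣ m` and
`p ∣ N`) and is replaced by the symmetry under the Atkin–Lehner involution `w_Q` at the prime-to-`p`
part `Q = N/p` of the level. Theorems only (no definition, no named fact).

For `f ∈ S₂(Γ₀(N))`, an exact divisor `Q ∥ N`, `w_Q f = ε f` (`atkinLehnerInvolution N 2 Q`,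
`ε² = 1`), `m ≥ 1` with `N ∣ Q m`, and integers `a, u, v` with `a m − u Q v = 1`:

* `slash_eq_slash_atkinLehnerW_of_entries` — any integer matrix `(Qa, b; Nc, Qd)` of determinant
  `Q` ("a version of `w(Q)`", Knapp 1993, Lemma 9.24) slashes like the canonical `w(Q)`;
* `apply_ofComplex_eq_of_atkinLehner` — **the flip**: `β = (Qv, −a; Qm, −Qu)` is a version of
  `w(Q)` with `β(u/m + it) = v/m + i/(Q m² t)`, whence `f(u/m + it) = −ε f(v/m + i/(Q m² t))/(Q m² t²)`;
* `modularSymbol_eq_rayTail_sub_atkinLehner` (two-sided series),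
  `modularSymbol_div_eq_neg_mul_atkinLehner` — **`{∞, u/m}_f = −ε {∞, v/m}_f`** — and the plus /
  normalised / rational symbol versions (`…plusSymbol…`, `…normalizedPlusSymbol…`,
  `ratPlusSymbol_div_eq_mul_atkinLehner`);
* `ratPlusSymbol_eq_mul_of_atkinLehner_of_dvd` — **at `p ‖ N`, `N = pM`, `w_M f = −σ f`:
  `[u/p^L]⁺ = σ [u'/p^L]⁺` whenever `M u u' ≡ −1 (mod p^L)`**, `L ≥ 1`: the symmetry of the
  Mazur–Tate–Teitelbaum measure `μ(u + p^Lℤ_p) = α^{-L}[u/p^L]⁺` (`ε(p) = 0`, §I.10) under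
  `x ↦ −1/(Mx)`; for the newform of an elliptic curve `σ = −ε_M = −a_p w_E` (the eigenvalue
  `ε_M = ∏_{q ∣ M} λ(Q_q)` is computed in `AtkinLehnerComplementEigenvalueProofs`).

## References

* B. Mazur, J. Tate, J. Teitelbaum, *On `p`-adic analogues of the conjectures of Birch and
  Swinnerton-Dyer*, Invent. Math. 84 (1986), 1–48, §I.10, §I.17.
* A. W. Knapp, *Elliptic curves*, Math. Notes 40, Princeton UP 1993 (held:
  `book:knapp1993-elliptic-curves-volume-40`): Lemma 9.24, Thm. 9.27 (PDF pp. 214–218).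
* A. O. L. Atkin, J. Lehner, *Hecke operators on `Γ₀(m)`*, Math. Ann. 185 (1970), Lemmas 8–10, Thm. 3.
* J. E. Cremona, *Algorithms for modular elliptic curves*, 2nd ed., CUP 1997, §2.10–2.11.
-/

noncomputable section

open scoped MatrixGroups ModularForm

open CongruenceSubgroup Matrix.SpecialLinearGroup UpperHalfPlane Complex MeasureTheory Set

namespace Literature.NumberTheory.EllipticCurves.ModularForms

/-! ### Versions of `w(Q)` -/

section Versions

variable (N : ℕ) (k : ℤ) (Q : ℕ) [NeZero Q]

/-- **Any Atkin–Lehner matrix for `Q ∥ N` slashes like the canonical one** (Knapp 1993, proof of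
Lemma 9.24, PDF pp. 215–216: the operator `w_Q` "is independent of the choice of defining matrix
`w(Q)`"): if `m = (Qa, b; Nc, Qd) ∈ GL(2, ℝ)` with `a, b, c, d ∈ ℤ` and `det m = Q`, then
`m = γ w(Q)` with `γ = (Qa − bR, bx − ay; N(c − d), Qdx − Rcy) ∈ Γ₀(N)` (`R = N/Q`,
`w(Q) = (Qx, y; N, Q)`, `Qx − Ry = 1`), so `f ∣[k] m = f ∣[k] w(Q)` on `S_k(Γ₀(N))`. The Fricke case
`Q = N` is `slash_eq_slash_frickeGL_of_entries`. [cite: Knapp1993, Lemma 9.24] -/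
theorem slash_eq_slash_atkinLehnerW_of_entries (hQN : Q ∣ N) (hc : Nat.Coprime Q (N / Q))
    {m : GL (Fin 2) ℝ} {a b c d : ℤ}
    (hm : (m : Matrix (Fin 2) (Fin 2) ℝ) = !![(Q : ℝ) * a, b; (N : ℝ) * c, (Q : ℝ) * d])
    (hdet : m.det.val = Q) (f : CuspForm (Gamma0 N) k) :
    ⇑f ∣[k] m = ⇑f ∣[k] glCast (atkinLehnerW N Q : GL (Fin 2) ℚ) := by
  set R : ℕ := N / Q with hR
  have hNQR : N = Q * R := by rw [hR, mul_comm, Nat.div_mul_cancel hQN]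
  have hQ0 : (Q : ℝ) ≠ 0 := by exact_mod_cast NeZero.ne Q
  set x : ℤ := (atkinLehnerSL N Q) 0 0 with hx
  set y : ℤ := (atkinLehnerSL N Q) 0 1 with hy
  have hbez : (Q : ℤ) * x - (R : ℤ) * y = 1 := atkinLehnerSL_bezout N Q hc
  have hbezR : (Q : ℝ) * x - (R : ℝ) * y = 1 := by exact_mod_cast hbez
  -- `Q a d − R b c = 1`
  have hdetR : (Q : ℝ) * ((Q : ℝ) * a * d - (R : ℝ) * b * c) = (Q : ℝ) * 1 := by
    have h := hdet
    rw [Matrix.GeneralLinearGroup.val_det_apply, hm, Matrix.det_fin_two_of] at h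
    have hN : (N : ℝ) = Q * R := by exact_mod_cast hNQR
    rw [hN] at h
    linear_combination h
  have h1R : (Q : ℝ) * a * d - (R : ℝ) * b * c = 1 := mul_left_cancel₀ hQ0 hdetR
  have h1 : (Q : ℤ) * a * d - (R : ℤ) * b * c = 1 := by exact_mod_cast h1R
  let γ : SL(2, ℤ) := ⟨!![(Q : ℤ) * a - b * R, b * x - a * y; (N : ℤ) * (c - d),
      (Q : ℤ) * d * x - (R : ℤ) * c * y], by
    rw [Matrix.det_fin_two_of]
    have hN : (N : ℤ) = Q * R := by exact_mod_cast hNQR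
    rw [hN]
    linear_combination ((Q : ℤ) * x - (R : ℤ) * y) * h1 + hbez⟩
  have hγ : γ ∈ Gamma0 N := by
    rw [Gamma0_mem]
    simp [γ]
  have hmul : m = mapGL ℝ γ * glCast (atkinLehnerW N Q : GL (Fin 2) ℚ) := by
    refine Units.ext ?_
    rw [Matrix.GeneralLinearGroup.coe_mul, val_mapGL', val_glCast_atkinLehnerW N Q hQN hc, hm,
      ← hx, ← hy]
    have hN : (N : ℝ) = Q * R := by exact_mod_cast hNQR
    ext i j
    fin_cases i <;> fin_cases j <;> simp [Matrix.mul_apply, Fin.sum_univ_two, γ, hN]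
    · linear_combination (-((Q : ℝ) * a)) * hbezR
    · linear_combination (-(b : ℝ)) * hbezR
    · linear_combination (-((Q : ℝ) * R * c)) * hbezR
    · linear_combination (-((Q : ℝ) * d)) * hbezR
  rw [hmul, SlashAction.slash_mul,
    SlashInvariantFormClass.slash_action_eq f _ (Subgroup.mem_map_of_mem _ hγ)]

end Versions

/-! ### The flip `u/m + it ↔ v/m + i/(Q m² t)` under `w_Q` -/

section Flip

variable {N : ℕ} [NeZero N] {Q : ℕ} [NeZero Q]

/-- **The Atkin–Lehner flip.** Let `f ∈ S_2(Γ₀(N))` with `w_Q f = ε f` (`Q ∥ N`), `ε² = 1`, let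
`m ≥ 1` with `N ∣ Q m` (the denominator is divisible by the complementary divisor `N/Q`), and let
`a, u, v ∈ ℤ` with `a m - u Q v = 1`. Then `β = (Qv, -a; Qm, -Qu)` is an Atkin–Lehner matrix for `Q`
(`det β = Q(am - Quv) = Q`), `β(u/m + it) = v/m + i/(Q m² t)`, and evaluating `f ∣[2] β = ε f` at
`u/m + it` gives `f(u/m + it) = -ε f(v/m + i/(Q m² t)) / (Q m² t²)` for `t > 0`. The Fricke case
`Q = N` (`(m, N) = 1`) is `apply_ofComplex_eq_of_isFrickeEigen`; at the other extreme the
denominator `m` may be a power of a prime `p ∥ N` with `Q = N/p` — the case of the functional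
equation of the `p`-adic `L`-function at a prime of multiplicative reduction
(Mazur–Tate–Teitelbaum 1986, §I.17). [cite: Knapp1993, Lemma 9.24]
[cite: MazurTateTeitelbaum1986Invent, §I.17] -/
theorem apply_ofComplex_eq_of_atkinLehner (hQN : Q ∣ N) (hc : Nat.Coprime Q (N / Q))
    (f : CuspForm (Gamma0 N) 2) {ε : ℂ} (hε : atkinLehnerInvolution N 2 Q f = ε • f)
    (hε1 : ε ^ 2 = 1) {m : ℕ} (hm : 0 < m) (hNm : N ∣ Q * m) {a u v : ℤ}
    (huv : a * m - u * (Q * v) = 1) {t : ℝ} (ht : 0 < t) :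
    f (ofComplex ((u : ℂ) / m + t * Complex.I)) =
      -ε / ((Q : ℂ) * (m : ℂ) ^ 2 * (t : ℂ) ^ 2) *
        f (ofComplex ((v : ℂ) / m + ((1 / ((Q : ℝ) * m ^ 2 * t) : ℝ) : ℂ) * Complex.I)) := by
  have hQ0 : (Q : ℂ) ≠ 0 := Nat.cast_ne_zero.mpr (NeZero.ne Q)
  have hQpos : (0 : ℝ) < Q := Nat.cast_pos.mpr (NeZero.pos Q)
  have hm0 : (m : ℂ) ≠ 0 := Nat.cast_ne_zero.mpr hm.ne'
  have ht0 : (t : ℂ) ≠ 0 := Complex.ofReal_ne_zero.mpr ht.ne'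
  obtain ⟨C, hC⟩ := hNm
  have hCR : (N : ℝ) * C = Q * m := by exact_mod_cast hC.symm
  -- the matrix `β = (Qv, -a; NC, -Qu) = (Qv, -a; Qm, -Qu)`, `det β = Q`
  have hdetA : Matrix.det !![(Q : ℝ) * v, ((-a : ℤ) : ℝ); (N : ℝ) * C, (Q : ℝ) * ((-u : ℤ) : ℝ)] = Q := by
    rw [Matrix.det_fin_two_of]
    push_cast
    have h1 : (a : ℝ) * m - u * (Q * v) = 1 := by exact_mod_cast huv
    linear_combination (a : ℝ) * hCR + (Q : ℝ) * h1
  set β : GL (Fin 2) ℝ := Matrix.GeneralLinearGroup.mkOfDetNeZero _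
    (by rw [hdetA]; exact hQpos.ne') with hβ
  have hβval : (β : Matrix (Fin 2) (Fin 2) ℝ) =
      !![(Q : ℝ) * v, ((-a : ℤ) : ℝ); (N : ℝ) * C, (Q : ℝ) * ((-u : ℤ) : ℝ)] := by
    rw [hβ, Matrix.GeneralLinearGroup.val_mkOfDetNeZero]
  have hdet : β.det.val = Q := by
    rw [Matrix.GeneralLinearGroup.val_det_apply, hβval, hdetA]
  have hdetpos : 0 < β.det.val := by rw [hdet]; exact hQpos
  -- `f ∣[2] β = f ∣[2] w(Q)` and the eigen-property, pointwise
  have hslash := slash_eq_slash_atkinLehnerW_of_entries N 2 Q hQN hc hβval hdet f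
  -- the point `z₀ = u/m + it` and its image `w₀ = v/m + i/(Q m² t)`
  set z₀ : ℂ := (u : ℂ) / m + t * Complex.I with hz₀
  have hz₀im : 0 < z₀.im := by simpa [hz₀] using ht
  set T : ℝ := 1 / ((Q : ℝ) * m ^ 2 * t) with hT
  have hTC : (T : ℂ) = 1 / ((Q : ℂ) * (m : ℂ) ^ 2 * (t : ℂ)) := by rw [hT]; push_cast; ring
  set w₀ : ℂ := (v : ℂ) / m + (T : ℂ) * Complex.I with hw₀
  have hden : denom β z₀ = Complex.I * Q * m * t := by
    rw [denom]
    have h10 : ((β 1 0 : ℝ) : ℂ) = (N : ℂ) * C := by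
      rw [show (β 1 0 : ℝ) = (β : Matrix (Fin 2) (Fin 2) ℝ) 1 0 from rfl, hβval]; simp
    have h11 : ((β 1 1 : ℝ) : ℂ) = -((Q : ℂ) * u) := by
      rw [show (β 1 1 : ℝ) = (β : Matrix (Fin 2) (Fin 2) ℝ) 1 1 from rfl, hβval]; simp
    have hCC : (N : ℂ) * C = Q * m := by exact_mod_cast hC.symm
    rw [h10, h11, hCC, hz₀]
    field_simp
    ring
  have hnum : num β z₀ = -1 / m + Complex.I * Q * v * t := by
    rw [num]
    have h00 : ((β 0 0 : ℝ) : ℂ) = (Q : ℂ) * v := by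
      rw [show (β 0 0 : ℝ) = (β : Matrix (Fin 2) (Fin 2) ℝ) 0 0 from rfl, hβval]; simp
    have h01 : ((β 0 1 : ℝ) : ℂ) = -(a : ℂ) := by
      rw [show (β 0 1 : ℝ) = (β : Matrix (Fin 2) (Fin 2) ℝ) 0 1 from rfl, hβval]; simp
    have h1 : (a : ℂ) * m - u * (Q * v) = 1 := by exact_mod_cast huv
    rw [h00, h01, hz₀]
    field_simp
    linear_combination (-1 : ℂ) * h1
  have hmoeb : ((β • ofComplex z₀ : ℍ) : ℂ) = w₀ := by
    rw [coe_smul_of_det_pos hdetpos, ofComplex_apply_of_im_pos hz₀im, hnum, hden, hw₀, hTC]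
    field_simp
    ring_nf
    rw [Complex.I_sq]
    ring
  have hw₀im : 0 < w₀.im := by
    have := (β • ofComplex z₀).im_pos
    rwa [show (β • ofComplex z₀).im = w₀.im by rw [← UpperHalfPlane.coe_im, hmoeb]] at this
  have hpt : β • ofComplex z₀ = ofComplex w₀ := by
    ext1; rw [hmoeb, ofComplex_apply_of_im_pos hw₀im]
  -- evaluate `f ∣[2] β = ε f` at `z₀`
  have key := congr_fun hslash (ofComplex z₀)
  rw [slash_atkinLehnerW_apply hQN hc hε, ModularForm.slash_apply, hpt, hdet,
    abs_of_nonneg hQpos.le] at key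
  have hσ : ∀ z : ℂ, σ β z = z := fun z ↦ by
    rw [σ, if_pos hdetpos]; rfl
  have hdenH : denom β ((ofComplex z₀ : ℍ) : ℂ) = Complex.I * Q * m * t := by
    rw [ofComplex_apply_of_im_pos hz₀im]; exact hden
  rw [hσ, hdenH] at key
  -- `key : f(w₀) · Q · (iQmt)^{-2} = ε f(z₀)`
  have hf : (f : ℍ → ℂ) (ofComplex z₀) = ε * (ε * (f : ℍ → ℂ) (ofComplex z₀)) := by
    rw [← mul_assoc, ← sq, hε1, one_mul]
  rw [hf, ← key, show (2 : ℤ) - 1 = 1 by norm_num, zpow_one, _root_.zpow_neg, zpow_ofNat]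
  push_cast
  field_simp
  ring_nf
  rw [Complex.I_sq]
  ring

end Flip

/-! ### Two-sided series and the symmetry of the modular symbols -/

section Symbols

variable {N : ℕ} [NeZero N] {Q : ℕ} [NeZero Q]

/-- **Two-sided series for `{∞, u/m}_f`, Atkin–Lehner form**: for `f ∈ S_2(Γ₀(N))` with
`w_Q f = ε f` (`Q ∥ N`, `ε² = 1`), `m ≥ 1` with `N ∣ Q m`, `a m - u Q v = 1` and any `Y > 0`,
`{∞, u/m}_f = T_f(u/m, Y) - ε T_f(v/m, 1/(Q m² Y))` (split the ray at height `Y`, flip the lower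
piece by `apply_ofComplex_eq_of_atkinLehner`, substitute `t = 1/(Q m² s)`). The Fricke case is
`modularSymbol_eq_rayTail_sub`. [cite: Knapp1993, Lemma 9.24] [cite: MazurTateTeitelbaum1986Invent, §I.17] -/
theorem modularSymbol_eq_rayTail_sub_atkinLehner (hQN : Q ∣ N) (hc : Nat.Coprime Q (N / Q))
    (f : CuspForm (Gamma0 N) 2) {ε : ℂ} (hε : atkinLehnerInvolution N 2 Q f = ε • f)
    (hε1 : ε ^ 2 = 1) {m : ℕ} (hm : 0 < m) (hNm : N ∣ Q * m) {a u v : ℤ}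
    (huv : a * m - u * (Q * v) = 1) {Y : ℝ} (hY : 0 < Y) :
    modularSymbol f ((u : ℚ) / m) =
      rayTail f ((u : ℚ) / m) Y - ε * rayTail f ((v : ℚ) / m) (1 / ((Q : ℝ) * m ^ 2 * Y)) := by
  have hQ : (0 : ℝ) < Q := Nat.cast_pos.mpr (NeZero.pos Q)
  set M : ℝ := (Q : ℝ) * m ^ 2 with hM
  have hMpos : 0 < M := by positivity
  have hY' : 0 < 1 / (M * Y) := by positivity
  set F : ℝ → ℂ := fun t ↦ f (ofComplex ((((u : ℚ) / m : ℚ) : ℂ) + t * Complex.I)) with hF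
  set G : ℝ → ℂ := fun s ↦ f (ofComplex ((((v : ℚ) / m : ℚ) : ℂ) + s * Complex.I)) with hG
  -- integrability and splitting at `Y`
  have hFint : IntegrableOn F (Ioi 0) := integrableOn_translate_integrand f _
  have hsplit : ∫ t in Ioi 0, F t = (∫ t in Ioc 0 Y, F t) + ∫ t in Ioi Y, F t := by
    rw [← setIntegral_union (Set.Ioc_disjoint_Ioi le_rfl) measurableSet_Ioi
      (hFint.mono_set Ioc_subset_Ioi_self) (hFint.mono_set (Ioi_subset_Ioi hY.le)),
      Ioc_union_Ioi_eq_Ioi hY.le]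
  -- the flipped lower piece
  have hflip : ∫ t in Ioc 0 Y, F t = -ε * ∫ s in Ioi (1 / (M * Y)), G s := by
    refine setIntegral_Ioc_eq_of_flip hMpos hY fun t ht ↦ ?_
    rw [hF, hG]
    dsimp only
    have h := apply_ofComplex_eq_of_atkinLehner hQN hc f hε hε1 hm hNm huv ht
    push_cast at h ⊢
    rw [h, hM]
    push_cast
    ring_nf
  rw [modularSymbol, hsplit, hflip, mul_add, ← two_pi_mul_integral_Ioi_eq_rayTail f _ hY,
    ← two_pi_mul_integral_Ioi_eq_rayTail f _ hY']
  ring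

/-- **Atkin–Lehner symmetry of modular symbols**: under the hypotheses of
`modularSymbol_eq_rayTail_sub_atkinLehner`, `{∞, u/m}_f = -ε {∞, v/m}_f` (the relation
`a m - u Q v = 1` is symmetric in `u, v`; take `Y = 1` and `Y' = 1/(Q m²)`, the sum
`{∞, u/m} + ε {∞, v/m}` is `(1 - ε²) T(u/m, 1) = 0`). For `m = p^n`, `Q = N/p`, `p ∥ N` this is the
symmetry of the Mazur–Tate–Teitelbaum measure at a prime of multiplicative reduction
(Mazur–Tate–Teitelbaum 1986, §I.17). [cite: MazurTateTeitelbaum1986Invent, §I.17] -/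
theorem modularSymbol_div_eq_neg_mul_atkinLehner (hQN : Q ∣ N) (hc : Nat.Coprime Q (N / Q))
    (f : CuspForm (Gamma0 N) 2) {ε : ℂ} (hε : atkinLehnerInvolution N 2 Q f = ε • f)
    (hε1 : ε ^ 2 = 1) {m : ℕ} (hm : 0 < m) (hNm : N ∣ Q * m) {a u v : ℤ}
    (huv : a * m - u * (Q * v) = 1) :
    modularSymbol f ((u : ℚ) / m) = -ε * modularSymbol f ((v : ℚ) / m) := by
  have hQ : (0 : ℝ) < Q := Nat.cast_pos.mpr (NeZero.pos Q)
  have hm' : (0 : ℝ) < m := Nat.cast_pos.mpr hm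
  have hY' : (0 : ℝ) < 1 / ((Q : ℝ) * (m : ℝ) ^ 2 * 1) := by positivity
  have h1 := modularSymbol_eq_rayTail_sub_atkinLehner hQN hc f hε hε1 hm hNm huv one_pos
  have hvu : a * m - v * (Q * u) = 1 := by linear_combination huv
  have h2 := modularSymbol_eq_rayTail_sub_atkinLehner hQN hc f hε hε1 hm hNm hvu hY'
  have hYY : 1 / ((Q : ℝ) * (m : ℝ) ^ 2 * (1 / ((Q : ℝ) * (m : ℝ) ^ 2 * 1))) = 1 := by
    field_simp
  rw [hYY] at h2
  linear_combination h1 + ε * h2 - rayTail f ((u : ℚ) / m) 1 * hε1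

/-- **Atkin–Lehner symmetry of the plus symbols**: `({∞, u/m} + {∞, -u/m})/2 =
-ε ({∞, v/m} + {∞, -v/m})/2` (apply the symbol relation to `(u, v)` and to `(-u, -v)`).
[cite: MazurTateTeitelbaum1986Invent, §I.17] -/
theorem plusSymbol_div_eq_neg_mul_atkinLehner (hQN : Q ∣ N) (hc : Nat.Coprime Q (N / Q))
    (f : CuspForm (Gamma0 N) 2) {ε : ℂ} (hε : atkinLehnerInvolution N 2 Q f = ε • f)
    (hε1 : ε ^ 2 = 1) {m : ℕ} (hm : 0 < m) (hNm : N ∣ Q * m) {a u v : ℤ}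
    (huv : a * m - u * (Q * v) = 1) :
    plusSymbol f ((u : ℚ) / m) = -ε * plusSymbol f ((v : ℚ) / m) := by
  have h1 := modularSymbol_div_eq_neg_mul_atkinLehner hQN hc f hε hε1 hm hNm huv
  have huv' : a * m - (-u) * (Q * (-v)) = 1 := by linear_combination huv
  have h2 := modularSymbol_div_eq_neg_mul_atkinLehner hQN hc f hε hε1 hm hNm huv'
  have hu : (((-u : ℤ) : ℚ) / m) = -((u : ℚ) / m) := by push_cast; ring
  have hv : (((-v : ℤ) : ℚ) / m) = -((v : ℚ) / m) := by push_cast; ring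
  rw [hu, hv] at h2
  simp only [plusSymbol]
  rw [h1, h2]
  ring

/-- **Atkin–Lehner symmetry of the normalised plus symbols `[r] = re(plusSymbol)/Ω⁺_f`**, the sign
written as an integer: if `w_Q f = -σ f` with `σ ∈ ℤ`, `σ² = 1`, `m ≥ 1`, `N ∣ Q m` and
`a m - u Q v = 1`, then `[u/m]_f = σ [v/m]_f`. [cite: MazurTateTeitelbaum1986Invent, §I.17] -/
theorem normalizedPlusSymbol_div_eq_mul_atkinLehner (hQN : Q ∣ N) (hc : Nat.Coprime Q (N / Q))
    (f : CuspForm (Gamma0 N) 2) {σ : ℤ} (hε : atkinLehnerInvolution N 2 Q f = (-(σ : ℂ)) • f)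
    (hσ : σ ^ 2 = 1) {m : ℕ} (hm : 0 < m) (hNm : N ∣ Q * m) {a u v : ℤ}
    (huv : a * m - u * (Q * v) = 1) :
    normalizedPlusSymbol f ((u : ℚ) / m) = σ * normalizedPlusSymbol f ((v : ℚ) / m) := by
  have hε1 : (-(σ : ℂ)) ^ 2 = 1 := by rw [neg_sq]; exact_mod_cast hσ
  have h := plusSymbol_div_eq_neg_mul_atkinLehner hQN hc f hε hε1 hm hNm huv
  rw [neg_neg] at h
  simp only [normalizedPlusSymbol]
  rw [h, ← Complex.ofReal_intCast, Complex.re_ofReal_mul, mul_div_assoc]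

/-- **Atkin–Lehner symmetry of the rational plus symbols** `[r]⁺ = ratPlusSymbol f r` of
`PAdicLFunction` (transport by `ratPlusSymbol_eq_mul_of_normalizedPlusSymbol_eq`; no rationality
hypothesis needed). [cite: MazurTateTeitelbaum1986Invent, §I.17] -/
theorem ratPlusSymbol_div_eq_mul_atkinLehner (hQN : Q ∣ N) (hc : Nat.Coprime Q (N / Q))
    (f : CuspForm (Gamma0 N) 2) {σ : ℤ} (hε : atkinLehnerInvolution N 2 Q f = (-(σ : ℂ)) • f)
    (hσ : σ ^ 2 = 1) {m : ℕ} (hm : 0 < m) (hNm : N ∣ Q * m) {a u v : ℤ}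
    (huv : a * m - u * (Q * v) = 1) :
    ratPlusSymbol f ((u : ℚ) / m) = σ * ratPlusSymbol f ((v : ℚ) / m) :=
  ratPlusSymbol_eq_mul_of_normalizedPlusSymbol_eq f hσ
    (normalizedPlusSymbol_div_eq_mul_atkinLehner hQN hc f hε hσ hm hNm huv)

end Symbols


end Literature.NumberTheory.EllipticCurves.ModularForms

namespace Literature.NumberTheory.EllipticCurves

open ModularForms

/-! ### The symmetry of `[u/p^L]⁺` under `u ↦ -1/(Mu)` at a prime `p ∥ N`, `N = pM` -/

section Measure

variable {N : ℕ} [NeZero N] {f : CuspForm (Gamma0 N) 2} {p : ℕ} [Fact p.Prime]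

/-- **The Atkin–Lehner symmetry of the symbols `[u/p^L]⁺` at a prime `p ∥ N`** (Mazur–Tate–
Teitelbaum 1986, §I.17, the involution behind the functional equation of `L_p` at a prime of
multiplicative reduction): let `N = pM` with `p ∤ M` (so `M ∥ N`), let `f ∈ S₂(Γ₀(N))` satisfy
`w_M f = -σ f` with `σ ∈ ℤ`, `σ² = 1`, let `L ≥ 1`, and let `u, u'` be classes modulo `p^L` with
`M u u' = -1`. Then `[u/p^L]⁺ = σ [u'/p^L]⁺` for the rational plus symbols of `PAdicLFunction`
(`N = pM ∣ M p^L`; the determinant relation `A p^L - u M u' = 1` for the representatives in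
`[0, p^L)`). Hence every measure `μ_L(u) = α^{-L}[u/p^L]⁺` built from them — the Mazur–Tate–
Teitelbaum measure of `(f, α)` at `p ∣ N`, where `ε(p) = 0` kills the second term of (10.1) — is
`σ`-symmetric under `u ↦ -1/(Mu)`. For the newform of an elliptic curve with multiplicative
reduction at `p`, `σ = -ε_M = -a_p · w_E` (`w_N = w_p w_M`, `λ(p) = -a_p`, `w_E = -ε_N`).
[cite: MazurTateTeitelbaum1986Invent, §I.17] [cite: Knapp1993, Lemma 9.24] -/
theorem ratPlusSymbol_eq_mul_of_atkinLehner_of_dvd {M : ℕ} [NeZero M] (hNM : N = p * M)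
    (hpM : ¬ p ∣ M) {σ : ℤ} (hσ : σ ^ 2 = 1)
    (hW : atkinLehnerInvolution N 2 M f = (-(σ : ℂ)) • f) {L : ℕ} (hL : 1 ≤ L)
    {u u' : ZMod (p ^ L)} (h : (M : ZMod (p ^ L)) * u * u' = -1) :
    ratPlusSymbol f ((u.val : ℚ) / (p : ℚ) ^ L) = σ * ratPlusSymbol f ((u'.val : ℚ) / (p : ℚ) ^ L) := by
  haveI : NeZero (p ^ L) := ⟨pow_ne_zero _ (Fact.out : p.Prime).ne_zero⟩
  have hp : p.Prime := Fact.out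
  -- `M ∥ N`
  have hMN : M ∣ N := ⟨p, by rw [hNM, mul_comm]⟩
  have hNdM : N / M = p := by
    rw [hNM, Nat.mul_div_cancel _ (NeZero.pos M)]
  have hc : Nat.Coprime M (N / M) := by
    rw [hNdM]
    exact (Nat.Coprime.symm ((hp.coprime_iff_not_dvd).mpr hpM))
  -- `N ∣ M p^L`
  have hNm : N ∣ M * p ^ L := by
    obtain ⟨L', rfl⟩ : ∃ L', L = L' + 1 := ⟨L - 1, by omega⟩
    rw [hNM, pow_succ]
    exact ⟨p ^ L', by ring⟩
  -- `M a b ≡ -1 mod p^L` for the representatives `a = u.val`, `b = u'.val`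
  have hdvd : ((p ^ L : ℕ) : ℤ) ∣ (M : ℤ) * u.val * u'.val + 1 := by
    rw [← ZMod.intCast_zmod_eq_zero_iff_dvd]
    push_cast
    rw [ZMod.natCast_zmod_val, ZMod.natCast_zmod_val, h, neg_add_cancel]
  obtain ⟨A, hA⟩ := hdvd
  have h1 : A * ((p ^ L : ℕ) : ℤ) - (u.val : ℤ) * (M * (u'.val : ℤ)) = 1 := by
    linear_combination -hA
  have k1 := ratPlusSymbol_div_eq_mul_atkinLehner hMN hc f hW hσ (pow_pos hp.pos L) hNm h1
  push_cast at k1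
  exact k1

end Measure

end Literature.NumberTheory.EllipticCurves

end
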